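import Summits.QuantumFields.YangMills.Theorems.SmallFieldWideningLargeFieldMassRefinementTailOfSummableUnitTop
import Summits.QuantumFields.YangMills.Theorems.SmallFieldWideningLargeFieldMassRefinementTailSeriesTail

/-!
# Route `SmallFieldWidening`, crux r3 `LargeFieldMassRefinementTail` (stmt-QuantumFields-22884), line `birth`, skeleton v7 — EVERY EARLIER HYPOTHESIS OF THE
# LINE IMPLIES THE REGISTERED STUB `UnitTopSummable` (companion of `…OfSummableUnitTop`; lead `ym-line-sfw-p2` gen 25; the crux and rung R3 stay OPEN)

WHAT THIS IS NOT.  No probability estimate of Bałaban's programme is proved; nothing bears on the Yang–Mills mass gap; rung R3 (`YM3TorusSU2`) is a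
RECORD rung.  This file only orders the line's sufficient conditions: the registered stub of skeleton v7, `UnitTopSummable` (hypothesis of
`LargeFieldMassRefinementTailOfSummableUnitTop.largeFieldMassRefinementTail_of_unitTopSummable`: per family and per small coupling, a profile `q ≥ 0`
summable against the unit volume `(L^d)³` bounding the unit-top first-exit masses of the refinements `F.refine d` uniformly in the run length `K ≥ 2`),
is implied by

* `unitTopSummable_of_unitTopFam` — the width seat's per-family Gaussian form `UnitTopFam` (`…PerFamilyUnitTop.largeFieldMassRefinementTail_of_unitTopFam`;
  constants `n₁, N, C, c` depending on `F, γ`): profile `q d = 1` below `n₁`, `max C 0·β_d^N·e^{−c p_{b₀}(g_d)²}` from `n₁` on, summable by the tree's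
  per-height arithmetic `perHeight_bound` (`γ ≤ 1`);
* `unitTopSummable_of_unitTop` — the uniform normal form `UnitTop` of the v6 stub (`…UnitTop.deepStub_iff_unitTop`), at the profile `(1, 3)`;
* `unitTopSummable_of_deepStub` — the v6 stub text `stub_firstExitDeep` = the one open registered stub of crux `FirstExitWindowTailL` (stmt-QuantumFields-26243),
  so a landing there closes skeleton v7 in one line;
* `unitTopSummable_of_firstExitWindowTailL` — crux 26243 BY NAME;
* (§4) `unitTopSummable_of_stretchedExp` — ANY K-uniform stretched-exponential moderate-deviation tail `C·exp(−b·t_d^α)` (`t_d` = the threshold in units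
  of the natural scale `√(γL^{-d})`, any `α > 0`, constants per family): the crux prescribes no Gaussian rate.

References: T. Bałaban, Commun. Math. Phys. **102** (1985) 255–275 [Balaban1985UV3] ((7) p.257, (70)–(71) p.273).
-/

noncomputable section

open MeasureTheory Filter Topology
open Literature.MathematicalPhysics.QuantumFieldTheory.Balaban1983to89
open Literature.MathematicalPhysics.QuantumFieldTheory.Balaban1983to89.Missing
open Literature.MathematicalPhysics.QuantumFieldTheory.Balaban1983to89.T3ContinuumYM3Torus
open Literature.MathematicalPhysics.QuantumFieldTheory.Balaban1983to89.T3UnitScaleTilt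
open Literature.MathematicalPhysics.QuantumFieldTheory.Balaban1983to89.T3UnitLawDensityEML (ℰp measurableE_ℰp)
open Literature.MathematicalPhysics.QuantumFieldTheory.Balaban1983to89.T3LevelShift
open Literature.MathematicalPhysics.QuantumFieldTheory.Balaban1983to89.T3BareTailProfile
open Summit.QuantumFields.YangMills.Theorems.HistoryTailOfTwoSided (card_plaq_le_pow exists_perHeight_bound geometric_profile)
open Summit.QuantumFields.YangMills.Theorems.LargeFieldMassRefinementTailOfHeightTail (refine_refine)
open Summit.QuantumFields.YangMills.Theorems.LargeFieldMassRefinementTailOfFirstExit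
  (real_finestBad_le_card_mul refine_real_compl_histGood_le)
open Summit.QuantumFields.YangMills.Theorems.LargeFieldMassRefinementTailUnitTop
  (gibbsK_real_firstExit_eq_refine deepStub_iff_unitTop)
open Summit.QuantumFields.YangMills.Theorems.FirstExitWindow (tail_bound_mono one_le_inv_coupling)

namespace Summit.QuantumFields.YangMills.Theorems.LargeFieldMassRefinementTailOfSummableUnitTop

/-! ## §3 Every earlier registered stub / certificate hypothesis of the line implies `UnitTopSummable` -/

section Implications

/-- **`UnitTopSummable` ⇐ THE PER-FAMILY GAUSSIAN FORM `UnitTopFam`** of `…PerFamilyUnitTop.largeFieldMassRefinementTail_of_unitTopFam` (constants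
`n₁, N, C, c` depending on `F, γ`, Gaussian shape in the profile's `p_{b₀}`): the profile `q d = 1` for `d < n₁` and
`q d = max C 0·(γL^{-d})^{-N}·exp(−c·p_{b₀}(√(γL^{-d}))²)` for `d ≥ n₁` is summable against `(L^d)³` by the tree's per-height arithmetic
(`perHeight_bound`, γ ≤ 1). [cite: Balaban1985UV3, (7) p.257 and (71) p.273] -/
theorem unitTopSummable_of_unitTopFam
    (hU : ∀ L : ℕ, ∃ (b₀ p₀ : ℝ), 0 < b₀ ∧ 2 < p₀ ∧ ∀ (F : T3Family) (γ : ℝ), F.L = L → 0 < γ →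
      ∃ (n₁ N : ℕ) (C c : ℝ), 0 < c ∧ ∀ d : ℕ, n₁ ≤ d → ∀ K : ℕ, 2 ≤ K → ∀ p : Plaq ((F.refine d).P K) K,
        (gibbsK (F.refine d) ℰp (γ * ((F.L : ℝ)⁻¹) ^ d) K).real
            {V | (∀ k, k < K → PlaqSmall (θBal F.L (γ * ((F.L : ℝ)⁻¹) ^ d) b₀ p₀ (K - k))
                (Averaging.iter (fun i => BlockAveraging.blockAvg (P := (F.refine d).P K) (j := i) ℰp) k V)) ∧
              θBal F.L (γ * ((F.L : ℝ)⁻¹) ^ d) b₀ p₀ 0 ≤ GaugeGroup.dist1 (GaugeField.plaqHol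
                (Averaging.iter (fun i => BlockAveraging.blockAvg (P := (F.refine d).P K) (j := i) ℰp) K V) p)} ≤
          C * ((γ * ((F.L : ℝ)⁻¹) ^ d)⁻¹) ^ N *
            Real.exp (-(c * B10.pFun b₀ p₀ (Real.sqrt (γ * ((F.L : ℝ)⁻¹) ^ d)) ^ 2))) :
    ∀ L : ℕ, ∃ (b₀ p₀ γ₁ : ℝ), 0 < b₀ ∧ 2 < p₀ ∧ 0 < γ₁ ∧ γ₁ ≤ 1 ∧ ∀ (F : T3Family) (γ : ℝ), F.L = L → 0 < γ → γ ≤ γ₁ →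
      ∃ q : ℕ → ℝ, (∀ d, 0 ≤ q d) ∧ Summable (fun d : ℕ => ((F.L : ℝ) ^ d) ^ 3 * q d) ∧
        ∀ (d K : ℕ), 2 ≤ K → ∀ p : Plaq ((F.refine d).P K) K,
          (gibbsK (F.refine d) ℰp (γ * ((F.L : ℝ)⁻¹) ^ d) K).real
              {V | (∀ k, k < K → PlaqSmall (θBal F.L (γ * ((F.L : ℝ)⁻¹) ^ d) b₀ p₀ (K - k))
                  (Averaging.iter (fun i => BlockAveraging.blockAvg (P := (F.refine d).P K) (j := i) ℰp) k V)) ∧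
                θBal F.L (γ * ((F.L : ℝ)⁻¹) ^ d) b₀ p₀ 0 ≤ GaugeGroup.dist1 (GaugeField.plaqHol
                  (Averaging.iter (fun i => BlockAveraging.blockAvg (P := (F.refine d).P K) (j := i) ℰp) K V) p)} ≤ q d := by
  classical
  intro L
  obtain ⟨b₀, p₀, hb₀, hp₀, hU⟩ := hU L
  have hp₀1 : 1 ≤ p₀ := by linarith
  refine ⟨b₀, p₀, 1, hb₀, hp₀, one_pos, le_rfl, fun F γ hFL hγ hγ1 => ?_⟩
  obtain ⟨n₁, N, C, c, hc, h⟩ := hU F γ hFL hγ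
  have hL0 : (0 : ℝ) < F.L := by exact_mod_cast (zero_lt_one.trans F.hL.2)
  have hL1 : (1 : ℝ) ≤ F.L := by exact_mod_cast F.hL.2.le
  -- the Gaussian-shaped part and its per-height arithmetic
  obtain ⟨A', hA'0, hP⟩ := exists_perHeight_bound F hγ hγ1 hb₀ hp₀1 (le_max_right C 0) N hc
  set g : ℕ → ℝ := fun d => max C 0 * (F.scheme ℰp γ).β d ^ N *
    Real.exp (-(c * B10.pFun b₀ p₀ (Real.sqrt (γ * ((F.L : ℝ)⁻¹) ^ d)) ^ 2)) with hgdef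
  have hg0 : ∀ d, 0 ≤ g d := fun d =>
    mul_nonneg (mul_nonneg (le_max_right C 0) (pow_nonneg (F.scheme_β_nonneg ℰp hγ.le d) N)) (Real.exp_nonneg _)
  have hvol1 : 1 ≤ 9 * (8 * (F.L : ℝ) ^ (3 * F.m)) := by
    have : (1 : ℝ) ≤ (F.L : ℝ) ^ (3 * F.m) := one_le_pow₀ hL1
    nlinarith
  refine ⟨fun d => (if d < n₁ then (1 : ℝ) else 0) + g d, fun d => add_nonneg (by split_ifs <;> norm_num) (hg0 d), ?_,
    fun d K hK p => ?_⟩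
  · -- summability against `(L^d)³`: a finitely supported part plus the per-height bound `≤ A'·2^{-d}`
    have hfin : Summable (fun d : ℕ => ((F.L : ℝ) ^ d) ^ 3 * (if d < n₁ then (1 : ℝ) else 0)) := by
      refine summable_of_hasFiniteSupport ((Finset.range n₁).finite_toSet.subset ?_)
      intro d hd
      simp only [Function.mem_support, ne_eq, mul_eq_zero, not_or] at hd
      simp only [Finset.coe_range, Set.mem_Iio]
      by_contra hlt
      exact hd.2 (if_neg hlt)
    have hgs : Summable (fun d : ℕ => ((F.L : ℝ) ^ d) ^ 3 * g d) := by
      refine Summable.of_nonneg_of_le (fun d => mul_nonneg (pow_nonneg (pow_nonneg hL0.le d) 3) (hg0 d))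
        (fun d => ?_) ((geometric_profile hA'0).2.1)
      calc ((F.L : ℝ) ^ d) ^ 3 * g d ≤ (9 * (8 * (F.L : ℝ) ^ (3 * F.m))) * (((F.L : ℝ) ^ d) ^ 3 * g d) :=
            le_mul_of_one_le_left (mul_nonneg (pow_nonneg (pow_nonneg hL0.le d) 3) (hg0 d)) hvol1
        _ = (9 * (8 * (F.L : ℝ) ^ (3 * F.m) * ((F.L : ℝ) ^ d) ^ 3)) * g d := by ring
        _ ≤ A' * ((1 : ℝ) / 2) ^ d := hP d
    have := hfin.add hgs
    refine this.congr fun d => ?_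
    ring
  · haveI := isProbabilityMeasure_gibbsK (F.refine d) ℰp
      (mul_nonneg hγ.le (pow_nonneg (inv_nonneg.mpr hL0.le) d)) K
    show _ ≤ (if d < n₁ then (1 : ℝ) else 0) + g d
    by_cases hd : d < n₁
    · rw [if_pos hd]
      exact (measureReal_le_one).trans (le_add_of_nonneg_right (hg0 d))
    · rw [if_neg hd, zero_add]
      refine (h d (not_lt.mp hd) K hK p).trans ?_
      show C * (F.scheme ℰp γ).β d ^ N * Real.exp (-(c * B10.pFun b₀ p₀ (Real.sqrt (γ * ((F.L : ℝ)⁻¹) ^ d)) ^ 2)) ≤ g d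
      exact mul_le_mul_of_nonneg_right
        (mul_le_mul_of_nonneg_right (le_max_left C 0) (pow_nonneg (F.scheme_β_nonneg ℰp hγ.le d) N)) (Real.exp_nonneg _)

/-- **`UnitTopSummable` ⇐ THE UNIFORM NORMAL FORM `UnitTop`** of the v6 stub (`LargeFieldMassRefinementTailUnitTop.deepStub_iff_unitTop`): instantiate at
the profile `(1, 3)`, every family, and use `γL^{-d} ≤ γ ≤ γ₁`. [cite: Balaban1985UV3, (7) p.257 and (71) p.273] -/
theorem unitTopSummable_of_unitTop
    (hT : ∀ (L : ℕ) (b₀ p₀ : ℝ), 0 < b₀ → 2 < p₀ → ∃ (γ₁ C c : ℝ) (N : ℕ), 0 < γ₁ ∧ γ₁ ≤ 1 ∧ 0 < c ∧ 0 ≤ C ∧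
      ∀ (F : T3Family) (γ : ℝ), F.L = L → 0 < γ → γ ≤ γ₁ → ∀ (K : ℕ), 2 ≤ K → ∀ p : Plaq (F.P K) K,
        (gibbsK F ℰp γ K).real {U | (∀ k, k < K → PlaqSmall (θBal F.L γ b₀ p₀ (K - k))
            (Averaging.iter (fun i => BlockAveraging.blockAvg (P := F.P K) (j := i) ℰp) k U)) ∧
          θBal F.L γ b₀ p₀ 0 ≤ GaugeGroup.dist1 (GaugeField.plaqHol
            (Averaging.iter (fun i => BlockAveraging.blockAvg (P := F.P K) (j := i) ℰp) K U) p)} ≤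
        C * (γ⁻¹) ^ N * Real.exp (-(c * B10.pFun b₀ p₀ (Real.sqrt γ) ^ 2))) :
    ∀ L : ℕ, ∃ (b₀ p₀ γ₁ : ℝ), 0 < b₀ ∧ 2 < p₀ ∧ 0 < γ₁ ∧ γ₁ ≤ 1 ∧ ∀ (F : T3Family) (γ : ℝ), F.L = L → 0 < γ → γ ≤ γ₁ →
      ∃ q : ℕ → ℝ, (∀ d, 0 ≤ q d) ∧ Summable (fun d : ℕ => ((F.L : ℝ) ^ d) ^ 3 * q d) ∧
        ∀ (d K : ℕ), 2 ≤ K → ∀ p : Plaq ((F.refine d).P K) K,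
          (gibbsK (F.refine d) ℰp (γ * ((F.L : ℝ)⁻¹) ^ d) K).real
              {V | (∀ k, k < K → PlaqSmall (θBal F.L (γ * ((F.L : ℝ)⁻¹) ^ d) b₀ p₀ (K - k))
                  (Averaging.iter (fun i => BlockAveraging.blockAvg (P := (F.refine d).P K) (j := i) ℰp) k V)) ∧
                θBal F.L (γ * ((F.L : ℝ)⁻¹) ^ d) b₀ p₀ 0 ≤ GaugeGroup.dist1 (GaugeField.plaqHol
                  (Averaging.iter (fun i => BlockAveraging.blockAvg (P := (F.refine d).P K) (j := i) ℰp) K V) p)} ≤ q d := by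
  -- the uniform form gives the per-family Gaussian form with `n₁ = 0`; then `unitTopSummable_of_unitTopFam` (whose `γ₁` is `1` — but we need
  -- `γ ≤ γ₁` of the uniform form, so we prove the statement directly instead)
  intro L
  obtain ⟨γ₁, C, c, N, hγ₁, hγ₁1, hc, hC, h⟩ := hT L 1 3 one_pos (by norm_num)
  refine ⟨1, 3, γ₁, one_pos, by norm_num, hγ₁, hγ₁1, fun F γ hFL hγ hγle => ?_⟩
  have hγ1 : γ ≤ 1 := hγle.trans hγ₁1
  have hL0 : (0 : ℝ) < F.L := by exact_mod_cast (zero_lt_one.trans F.hL.2)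
  have hL1 : (1 : ℝ) ≤ F.L := by exact_mod_cast F.hL.2.le
  have hq1 : ((F.L : ℝ)⁻¹) ≤ 1 := inv_le_one_of_one_le₀ hL1
  have hq0 : (0 : ℝ) ≤ ((F.L : ℝ)⁻¹) := inv_nonneg.mpr hL0.le
  obtain ⟨A', hA'0, hP⟩ := exists_perHeight_bound F hγ hγ1 one_pos (by norm_num : (1 : ℝ) ≤ 3) hC N hc
  set g : ℕ → ℝ := fun d => C * (F.scheme ℰp γ).β d ^ N *
    Real.exp (-(c * B10.pFun 1 3 (Real.sqrt (γ * ((F.L : ℝ)⁻¹) ^ d)) ^ 2)) with hgdef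
  have hg0 : ∀ d, 0 ≤ g d := fun d =>
    mul_nonneg (mul_nonneg hC (pow_nonneg (F.scheme_β_nonneg ℰp hγ.le d) N)) (Real.exp_nonneg _)
  have hvol1 : 1 ≤ 9 * (8 * (F.L : ℝ) ^ (3 * F.m)) := by
    have : (1 : ℝ) ≤ (F.L : ℝ) ^ (3 * F.m) := one_le_pow₀ hL1
    nlinarith
  refine ⟨g, hg0, ?_, fun d K hK p => ?_⟩
  · refine Summable.of_nonneg_of_le (fun d => mul_nonneg (pow_nonneg (pow_nonneg hL0.le d) 3) (hg0 d))
      (fun d => ?_) ((geometric_profile hA'0).2.1)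
    calc ((F.L : ℝ) ^ d) ^ 3 * g d ≤ (9 * (8 * (F.L : ℝ) ^ (3 * F.m))) * (((F.L : ℝ) ^ d) ^ 3 * g d) :=
          le_mul_of_one_le_left (mul_nonneg (pow_nonneg (pow_nonneg hL0.le d) 3) (hg0 d)) hvol1
      _ = (9 * (8 * (F.L : ℝ) ^ (3 * F.m) * ((F.L : ℝ) ^ d) ^ 3)) * g d := by ring
      _ ≤ A' * ((1 : ℝ) / 2) ^ d := hP d
  · -- the uniform bound for the family `F.refine d` at `γL^{-d} ≤ γ ≤ γ₁`
    have hγd : 0 < γ * ((F.L : ℝ)⁻¹) ^ d := mul_pos hγ (pow_pos (inv_pos.mpr hL0) d)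
    have hγdle : γ * ((F.L : ℝ)⁻¹) ^ d ≤ γ₁ :=
      ((mul_le_of_le_one_right hγ.le (pow_le_one₀ hq0 hq1))).trans hγle
    have happ := h (F.refine d) (γ * ((F.L : ℝ)⁻¹) ^ d) hFL hγd hγdle K hK p
    refine happ.trans ?_
    show C * ((γ * ((F.L : ℝ)⁻¹) ^ d)⁻¹) ^ N * Real.exp (-(c * B10.pFun 1 3 (Real.sqrt (γ * ((F.L : ℝ)⁻¹) ^ d)) ^ 2)) ≤ g d
    exact le_rfl

/-- **`UnitTopSummable` ⇐ THE v6 STUB TEXT `stub_firstExitDeep`** (= the one open registered stub of crux `FirstExitWindowTailL`, stmt-QuantumFields-26243):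
through the unit-top normal form.  So a landing of that stub closes skeleton v7 in one line. [cite: Balaban1985UV3, (7) p.257 and (71) p.273] -/
theorem unitTopSummable_of_deepStub
    (hD : ∀ (L : ℕ) (b₀ p₀ b₂ : ℝ), 0 < b₀ → 2 < p₀ → b₀ ≤ b₂ → ∃ (γ₁ C c : ℝ) (N : ℕ), 0 < γ₁ ∧ γ₁ ≤ 1 ∧ 0 < c ∧ 0 ≤ C ∧
      ∀ (F : T3Family) (γ : ℝ), F.L = L → 0 < γ → γ ≤ γ₁ → ∀ (K j : ℕ), 2 ≤ j → j ≤ K → ∀ p : Plaq (F.P K) j,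
        (gibbsK F ℰp γ K).real {U | (∀ k, k < j → PlaqSmall (θBal F.L γ b₀ p₀ (K - k))
            (Averaging.iter (fun i => BlockAveraging.blockAvg (P := F.P K) (j := i) ℰp) k U)) ∧
          PlaqSmall (θBal F.L γ b₂ p₀ (K - j)) (Averaging.iter (fun i => BlockAveraging.blockAvg (P := F.P K) (j := i) ℰp) j U) ∧
          θBal F.L γ b₀ p₀ (K - j) ≤ GaugeGroup.dist1 (GaugeField.plaqHol
            (Averaging.iter (fun i => BlockAveraging.blockAvg (P := F.P K) (j := i) ℰp) j U) p)} ≤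
        C * ((γ * ((F.L : ℝ)⁻¹) ^ (K - j))⁻¹) ^ N * Real.exp (-(c * B10.pFun b₀ p₀ (Real.sqrt (γ * ((F.L : ℝ)⁻¹) ^ (K - j))) ^ 2))) :
    ∀ L : ℕ, ∃ (b₀ p₀ γ₁ : ℝ), 0 < b₀ ∧ 2 < p₀ ∧ 0 < γ₁ ∧ γ₁ ≤ 1 ∧ ∀ (F : T3Family) (γ : ℝ), F.L = L → 0 < γ → γ ≤ γ₁ →
      ∃ q : ℕ → ℝ, (∀ d, 0 ≤ q d) ∧ Summable (fun d : ℕ => ((F.L : ℝ) ^ d) ^ 3 * q d) ∧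
        ∀ (d K : ℕ), 2 ≤ K → ∀ p : Plaq ((F.refine d).P K) K,
          (gibbsK (F.refine d) ℰp (γ * ((F.L : ℝ)⁻¹) ^ d) K).real
              {V | (∀ k, k < K → PlaqSmall (θBal F.L (γ * ((F.L : ℝ)⁻¹) ^ d) b₀ p₀ (K - k))
                  (Averaging.iter (fun i => BlockAveraging.blockAvg (P := (F.refine d).P K) (j := i) ℰp) k V)) ∧
                θBal F.L (γ * ((F.L : ℝ)⁻¹) ^ d) b₀ p₀ 0 ≤ GaugeGroup.dist1 (GaugeField.plaqHol
                  (Averaging.iter (fun i => BlockAveraging.blockAvg (P := (F.refine d).P K) (j := i) ℰp) K V) p)} ≤ q d :=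
  unitTopSummable_of_unitTop (deepStub_iff_unitTop.mp hD)

/-- **`UnitTopSummable` ⇐ crux `FirstExitWindowTailL` BY NAME** (stmt-QuantumFields-26243; its heights `j ≥ 2` are the v6 stub text).  Conditional
certificate; nothing about the mass gap. [cite: Balaban1985UV3, (7) p.257 and (71) p.273] -/
theorem unitTopSummable_of_firstExitWindowTailL
    (hF : Summit.QuantumFields.YangMills.Theses.FirstExitWindow.FirstExitWindowTailL) :
    ∀ L : ℕ, ∃ (b₀ p₀ γ₁ : ℝ), 0 < b₀ ∧ 2 < p₀ ∧ 0 < γ₁ ∧ γ₁ ≤ 1 ∧ ∀ (F : T3Family) (γ : ℝ), F.L = L → 0 < γ → γ ≤ γ₁ →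
      ∃ q : ℕ → ℝ, (∀ d, 0 ≤ q d) ∧ Summable (fun d : ℕ => ((F.L : ℝ) ^ d) ^ 3 * q d) ∧
        ∀ (d K : ℕ), 2 ≤ K → ∀ p : Plaq ((F.refine d).P K) K,
          (gibbsK (F.refine d) ℰp (γ * ((F.L : ℝ)⁻¹) ^ d) K).real
              {V | (∀ k, k < K → PlaqSmall (θBal F.L (γ * ((F.L : ℝ)⁻¹) ^ d) b₀ p₀ (K - k))
                  (Averaging.iter (fun i => BlockAveraging.blockAvg (P := (F.refine d).P K) (j := i) ℰp) k V)) ∧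
                θBal F.L (γ * ((F.L : ℝ)⁻¹) ^ d) b₀ p₀ 0 ≤ GaugeGroup.dist1 (GaugeField.plaqHol
                  (Averaging.iter (fun i => BlockAveraging.blockAvg (P := (F.refine d).P K) (j := i) ℰp) K V) p)} ≤ q d := by
  refine unitTopSummable_of_deepStub fun L b₀ p₀ b₂ hb₀ hp₀ hb₂ => ?_
  obtain ⟨γ₁, C, c, N, hγ₁, hγ₁1, hc, h⟩ := hF L b₀ p₀ b₂ hb₀ hp₀ hb₂
  -- the route decl does not record `0 ≤ C`; replace `C` by `max C 0`
  refine ⟨γ₁, max C 0, c, N, hγ₁, hγ₁1, hc, le_max_right _ _, fun F γ hFL hγ hle K j hj hjK p => ?_⟩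
  refine (h F γ hFL hγ hle K j (by omega) hjK p).trans ?_
  have hβ0 : 0 ≤ ((γ * ((F.L : ℝ)⁻¹) ^ (K - j))⁻¹) ^ N :=
    pow_nonneg (inv_nonneg.mpr (mul_nonneg hγ.le (pow_nonneg (inv_nonneg.mpr (Nat.cast_nonneg _)) _))) N
  exact mul_le_mul_of_nonneg_right (mul_le_mul_of_nonneg_right (le_max_left C 0) hβ0) (Real.exp_nonneg _)

end Implications

/-! ## §4 Which RATE the stub needs: any K-uniform stretched-exponential moderate-deviation tail (appended by the lead, gen 25) -/

section Rate

/-- **THE GAUSSIAN-IN-THE-DEPTH COMPARISON**: for `a > 0`, `C ≥ 0` and every `d`, `(L^d)³ · C · e^{−a d²} ≤ C·e^{B²/(4a)} · 2^{−d}` with `B = 3 log L + log 2`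
(`L ≥ 1`). [folklore] -/
theorem pow_cube_mul_exp_neg_sq_le {L : ℝ} (hL : 1 ≤ L) {a : ℝ} (ha : 0 < a) {C : ℝ} (hC : 0 ≤ C) (d : ℕ) :
    (L ^ d) ^ 3 * (C * Real.exp (-(a * (d : ℝ) ^ 2))) ≤
      (C * Real.exp ((3 * Real.log L + Real.log 2) ^ 2 / (4 * a))) * ((1 : ℝ) / 2) ^ d := by
  have hL0 : 0 < L := one_pos.trans_le hL
  have hLpow : (L ^ d) ^ 3 = Real.exp (3 * ((d : ℝ) * Real.log L)) := by
    rw [← pow_mul, show (3 : ℝ) * ((d : ℝ) * Real.log L) = ((d * 3 : ℕ) : ℝ) * Real.log L by push_cast; ring,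
      Real.exp_nat_mul, Real.exp_log hL0]
  have hhalf : ((1 : ℝ) / 2) ^ d = Real.exp (-((d : ℝ) * Real.log 2)) := by
    rw [Real.exp_neg, Real.exp_nat_mul, Real.exp_log two_pos, one_div, inv_pow]
  have key : (L ^ d) ^ 3 * Real.exp (-(a * (d : ℝ) ^ 2)) ≤
      Real.exp ((3 * Real.log L + Real.log 2) ^ 2 / (4 * a)) * ((1 : ℝ) / 2) ^ d := by
    rw [hLpow, hhalf, ← Real.exp_add, ← Real.exp_add]
    refine Real.exp_le_exp.mpr ?_
    have hq := LargeFieldMassRefinementTail.quadratic_le_sq_div ha (3 * Real.log L + Real.log 2) (d : ℝ)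
    nlinarith
  calc (L ^ d) ^ 3 * (C * Real.exp (-(a * (d : ℝ) ^ 2))) = C * ((L ^ d) ^ 3 * Real.exp (-(a * (d : ℝ) ^ 2))) := by ring
    _ ≤ C * (Real.exp ((3 * Real.log L + Real.log 2) ^ 2 / (4 * a)) * ((1 : ℝ) / 2) ^ d) :=
        mul_le_mul_of_nonneg_left key hC
    _ = _ := by ring

/-- **THE THRESHOLD IN SIGMA UNITS GROWS AT LEAST LINEARLY IN THE DEPTH, ITS `α`-TH POWER AT LEAST QUADRATICALLY ONCE `α·p₀ ≥ 2`**: for `0 < γ ≤ 1`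
and `2 ≤ α·p₀`: `((log L)/2)²·d² ≤ (p_{1,p₀}(√(γL^{-d})))^α` — since `p_{1,p₀}(g_d) = (1 + ½(d·log L − log γ))^{p₀}` with base `≥ 1 + ½d·log L ≥ 1`.
[cite: Balaban1985UV3, (7) p.257] -/
theorem sq_depth_le_pFun_rpow (F : T3Family) {γ : ℝ} (hγ : 0 < γ) (hγ1 : γ ≤ 1) {p₀ α : ℝ} (hαp : 2 ≤ α * p₀) (d : ℕ) :
    (Real.log F.L / 2) ^ 2 * (d : ℝ) ^ 2 ≤ B10.pFun 1 p₀ (Real.sqrt (γ * ((F.L : ℝ)⁻¹) ^ d)) ^ α := by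
  have hL1 : (1 : ℝ) < F.L := by exact_mod_cast F.hL.2
  have hL0 : (0 : ℝ) < F.L := one_pos.trans hL1
  have hℓ0 : 0 < Real.log F.L := Real.log_pos hL1
  have hlogγ : Real.log γ ≤ 0 := Real.log_nonpos hγ.le hγ1
  have hinvK : ((F.L : ℝ)⁻¹) ^ d = ((F.L : ℝ) ^ d)⁻¹ := by rw [inv_pow]
  have hx0 : 0 < γ * ((F.L : ℝ)⁻¹) ^ d := by rw [hinvK]; positivity
  have hlogg : Real.log (Real.sqrt (γ * ((F.L : ℝ)⁻¹) ^ d))⁻¹ = ((d : ℝ) * Real.log F.L - Real.log γ) / 2 := by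
    rw [Real.log_inv, Real.log_sqrt hx0.le, Real.log_mul hγ.ne' (pow_ne_zero _ (inv_ne_zero hL0.ne')),
      Real.log_pow, Real.log_inv]
    ring
  set u : ℝ := 1 + ((d : ℝ) * Real.log F.L - Real.log γ) / 2 with hu
  have hud : (d : ℝ) * Real.log F.L / 2 ≤ u := by
    rw [hu]; have : 0 ≤ (d : ℝ) * Real.log F.L := by positivity
    linarith
  have hu1 : 1 ≤ u := by
    rw [hu]; have : 0 ≤ (d : ℝ) * Real.log F.L := by positivity
    linarith
  have hu0 : 0 ≤ u := zero_le_one.trans hu1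
  have hp : B10.pFun 1 p₀ (Real.sqrt (γ * ((F.L : ℝ)⁻¹) ^ d)) = u ^ p₀ := by
    unfold B10.pFun; rw [hlogg, one_mul]
  rw [hp, ← Real.rpow_mul hu0]
  -- `u^{p₀ α} ≥ u² ≥ (d log L / 2)²`
  have h2 : u ^ (2 : ℝ) ≤ u ^ (p₀ * α) :=
    Real.rpow_le_rpow_of_exponent_le hu1 (by rw [mul_comm]; exact hαp)
  have hsq : ((d : ℝ) * Real.log F.L / 2) ^ 2 ≤ u ^ (2 : ℝ) := by
    rw [Real.rpow_two]
    exact pow_le_pow_left₀ (by positivity) hud 2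
  calc (Real.log F.L / 2) ^ 2 * (d : ℝ) ^ 2 = ((d : ℝ) * Real.log F.L / 2) ^ 2 := by ring
    _ ≤ u ^ (2 : ℝ) := hsq
    _ ≤ u ^ (p₀ * α) := h2

/-- ★ **`UnitTopSummable` ⇐ ANY K-UNIFORM STRETCHED-EXPONENTIAL MODERATE-DEVIATION TAIL.**  If for every block size `L` there is an exponent `α > 0` such that
for EVERY profile `(b₀, p₀)` there is `γ₁ ∈ (0,1]` with: every family `F` (`F.L = L`) at every `0 < γ ≤ γ₁` has constants `C, b > 0` (depending on `F, γ`,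
the profile) bounding, for every depth `d` and uniformly in the run length `K ≥ 2`, the unit-top first-exit mass of every unit plaquette of `F.refine d` by
`C·exp(−b·t_d^α)`, `t_d = p_{b₀}(√(γL^{-d}))` the threshold IN UNITS OF THE NATURAL SCALE `√(γL^{-d})`, then `UnitTopSummable` (the registered stub of skeleton
v7) holds — at the profile `(1, max 3 (2/α))`: `t_d^α ≥ ((log L)/2)²·d²` (`sq_depth_le_pFun_rpow`) and `(L^d)³·C·e^{−a d²} ≤ C e^{B²/4a}·2^{−d}`.  So the crux
prescribes NO Gaussian rate: any exponent `α > 0` serves; a fixed polynomial moment bound (`t_d^{−q}`, i.e. `(d·log L)^{−p₀ q}` against `L^{−3d}`) does not.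
Conditional certificate; nothing about the mass gap. [cite: Balaban1985UV3, (7) p.257 and (70)-(71) p.273] -/
theorem unitTopSummable_of_stretchedExp
    (hE : ∀ L : ℕ, ∃ α : ℝ, 0 < α ∧ ∀ (b₀ p₀ : ℝ), 0 < b₀ → 2 < p₀ → ∃ γ₁ : ℝ, 0 < γ₁ ∧ γ₁ ≤ 1 ∧
      ∀ (F : T3Family) (γ : ℝ), F.L = L → 0 < γ → γ ≤ γ₁ → ∃ (C b : ℝ), 0 < b ∧
        ∀ (d K : ℕ), 2 ≤ K → ∀ p : Plaq ((F.refine d).P K) K,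
          (gibbsK (F.refine d) ℰp (γ * ((F.L : ℝ)⁻¹) ^ d) K).real
              {V | (∀ k, k < K → PlaqSmall (θBal F.L (γ * ((F.L : ℝ)⁻¹) ^ d) b₀ p₀ (K - k))
                  (Averaging.iter (fun i => BlockAveraging.blockAvg (P := (F.refine d).P K) (j := i) ℰp) k V)) ∧
                θBal F.L (γ * ((F.L : ℝ)⁻¹) ^ d) b₀ p₀ 0 ≤ GaugeGroup.dist1 (GaugeField.plaqHol
                  (Averaging.iter (fun i => BlockAveraging.blockAvg (P := (F.refine d).P K) (j := i) ℰp) K V) p)} ≤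
            C * Real.exp (-(b * B10.pFun b₀ p₀ (Real.sqrt (γ * ((F.L : ℝ)⁻¹) ^ d)) ^ α))) :
    ∀ L : ℕ, ∃ (b₀ p₀ γ₁ : ℝ), 0 < b₀ ∧ 2 < p₀ ∧ 0 < γ₁ ∧ γ₁ ≤ 1 ∧ ∀ (F : T3Family) (γ : ℝ), F.L = L → 0 < γ → γ ≤ γ₁ →
      ∃ q : ℕ → ℝ, (∀ d, 0 ≤ q d) ∧ Summable (fun d : ℕ => ((F.L : ℝ) ^ d) ^ 3 * q d) ∧
        ∀ (d K : ℕ), 2 ≤ K → ∀ p : Plaq ((F.refine d).P K) K,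
          (gibbsK (F.refine d) ℰp (γ * ((F.L : ℝ)⁻¹) ^ d) K).real
              {V | (∀ k, k < K → PlaqSmall (θBal F.L (γ * ((F.L : ℝ)⁻¹) ^ d) b₀ p₀ (K - k))
                  (Averaging.iter (fun i => BlockAveraging.blockAvg (P := (F.refine d).P K) (j := i) ℰp) k V)) ∧
                θBal F.L (γ * ((F.L : ℝ)⁻¹) ^ d) b₀ p₀ 0 ≤ GaugeGroup.dist1 (GaugeField.plaqHol
                  (Averaging.iter (fun i => BlockAveraging.blockAvg (P := (F.refine d).P K) (j := i) ℰp) K V) p)} ≤ q d := by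
  intro L
  obtain ⟨α, hα, hE⟩ := hE L
  -- the profile `(1, p₀)` with `p₀ = max 3 (2/α)`, so that `α p₀ ≥ 2`
  set p₀ : ℝ := max 3 (2 / α) with hp₀def
  have hp₀2 : 2 < p₀ := lt_of_lt_of_le (by norm_num) (le_max_left _ _)
  have hαp : 2 ≤ α * p₀ := by
    have h := mul_le_mul_of_nonneg_left (le_max_right 3 (2 / α)) hα.le
    rwa [mul_div_cancel₀ _ hα.ne'] at h
  obtain ⟨γ₁, hγ₁, hγ₁1, h⟩ := hE 1 p₀ one_pos hp₀2
  refine ⟨1, p₀, γ₁, one_pos, hp₀2, hγ₁, hγ₁1, fun F γ hFL hγ hγle => ?_⟩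
  have hγ1 : γ ≤ 1 := hγle.trans hγ₁1
  obtain ⟨C, b, hb, hbound⟩ := h F γ hFL hγ hγle
  have hL1 : (1 : ℝ) ≤ F.L := by exact_mod_cast F.hL.2.le
  have hL0 : (0 : ℝ) < F.L := one_pos.trans_le hL1
  have hℓ0 : 0 < Real.log F.L := Real.log_pos (by exact_mod_cast F.hL.2)
  -- the profile `q d = max C 0 · e^{−b t_d^α}` and its Gaussian-in-`d` majorant
  set a : ℝ := b * ((Real.log F.L / 2) ^ 2) with ha
  have ha0 : 0 < a := by positivity
  set q : ℕ → ℝ := fun d => max C 0 * Real.exp (-(b * B10.pFun 1 p₀ (Real.sqrt (γ * ((F.L : ℝ)⁻¹) ^ d)) ^ α)) with hqdef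
  have hq0 : ∀ d, 0 ≤ q d := fun d => mul_nonneg (le_max_right C 0) (Real.exp_nonneg _)
  have hqle : ∀ d : ℕ, q d ≤ max C 0 * Real.exp (-(a * (d : ℝ) ^ 2)) := by
    intro d
    refine mul_le_mul_of_nonneg_left (Real.exp_le_exp.mpr ?_) (le_max_right C 0)
    have hkey := sq_depth_le_pFun_rpow F hγ hγ1 hαp d
    have : a * (d : ℝ) ^ 2 = b * ((Real.log F.L / 2) ^ 2 * (d : ℝ) ^ 2) := by rw [ha]; ring
    rw [this]
    nlinarith [mul_le_mul_of_nonneg_left hkey hb.le]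
  refine ⟨q, hq0, ?_, fun d K hK p => ?_⟩
  · refine Summable.of_nonneg_of_le (fun d => mul_nonneg (pow_nonneg (pow_nonneg hL0.le d) 3) (hq0 d)) (fun d => ?_)
      ((summable_geometric_of_lt_one (by norm_num : (0 : ℝ) ≤ 1 / 2) (by norm_num : (1 : ℝ) / 2 < 1)).mul_left
        (max C 0 * Real.exp ((3 * Real.log F.L + Real.log 2) ^ 2 / (4 * a))))
    exact (mul_le_mul_of_nonneg_left (hqle d) (pow_nonneg (pow_nonneg hL0.le d) 3)).trans
      (pow_cube_mul_exp_neg_sq_le hL1 ha0 (le_max_right C 0) d)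
  · refine (hbound d K hK p).trans ?_
    exact mul_le_mul_of_nonneg_right (le_max_left C 0) (Real.exp_nonneg _)

end Rate

end Summit.QuantumFields.YangMills.Theorems.LargeFieldMassRefinementTailOfSummableUnitTop

end
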